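/-
Copyright: rh-split cell (nb-neg g7). HONEST LABEL: SPLITTING SEARCH over kernel-typed RH-EQUIVALENCES;
nothing in this file bears on the truth of RH.
-/
import Literature.Barriers.RiemannHypothesis.BettinGonek2017LowerBoundProofs
import Summits.RiemannHypothesis.RiemannHypothesis.Theorems.Splittings.NbGrowthDetectors
import HarnessLib

/-!
# NB natural approximants: an EFFECTIVE kernel visibility law for the tail-form conjunct
(rh-split, family nb, lens neg, gen 7)

The tail-form "natural approximant" conjunct of the Báez-Duarte–Bettin–Conrey–Farmer splitting is
`TAILnat(H, B) : ∀ N ≥ H, bcfDistSq N ≤ B`, where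
`bcfDistSq N = (1/2π) ∫ |1 - ζ V_N|²(½+it) dt/(¼+t²)` and `V_N = levinsonMollifier N`.
This file makes the kernel refutation of `TAILnat` at an off-line zero `ρ₀ = ½ + δ + iγ₀`
EFFECTIVE:

* `residueConst_le_one`, `one_div_eighteen_le_integral_log_sq` : bookkeeping for the constants;
* `bettinGonek_lowerBound_explicit` : the Bettin–Gonek 2017 §2 lower bound with the EXPLICIT constant
  `c(ρ₀) = c₁(ρ₀)²/390634`, `c₁(ρ₀) = residueConst ρ₀ = ‖ρ₀ - 1‖/‖ρ₀ + 3/2‖⁸`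
  (the tree's `BettinGonek2017_lowerBound_holds` only asserts `∃ c > 0`);
* `sum_log_sq_moment_le_of_window` : `∑_{N ≤ K+1} log²N·I_N(0,1) ≤ S + (K+1) log²(K+1)(2+5πB)`
  when `bcfDistSq N ≤ B` on the window `H ≤ N ≤ K+1` and the prefix `N < H` contributes `≤ S`;
* `kernel_visibility_ineq` : at a zero `ρ₀` with `Re ρ₀ ≥ ½`, for every `x ≥ 2`,
  `c₁² κ x^{2 Re ρ₀}/(16·390634) ≤ 2 (S + (⌊x⌋+1) log²(⌊x⌋+1) (2+5πB))`,
  `κ = ∫_0^1 |ζ(½+it)|² dt`;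
* `kernel_visibility` : if `Re ρ₀ ≥ ½ + δ` (`δ > 0`) and
  `6250144 (2S + 32(2+5πB)/δ²) < c₁² κ x^δ`, then SOME `N` with `H ≤ N ≤ ⌊x⌋+1` has
  `bcfDistSq N > B` — a POLYNOMIAL visibility scale `N_vis ≲ (C(B,S,δ) γ₀¹⁴/κ)^{1/δ}`, in place of
  the hyper-exponential three-lines scale, for the TAIL form (not for the liminf form).

Engine: the tree's kernel Bettin–Gonek §2 argument (`firstMoment_ineq`, `sq_le_of_firstMoment`,
`BettinGonek2017_lowerBound_integrated`) and nb-bridge g2's comparison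
`mollifiedSecondMoment_zero_one_le` (`I_N(0,1) ≤ 2 + 5π·bcfDistSq N`). Raw quantified forms only
(no new definitions). [cite: BettinGonek2017, §2; BettinConreyFarmer2013, (1)–(3)]

HONEST LABEL: «SPLITTING SEARCH over kernel-typed RH-EQUIVALENCES; a splitting A ∧ B ⟹ RH is
CONDITIONAL bookkeeping unless A and B are both proved; nothing here bears on the truth of RH.»
-/

set_option linter.dupNamespace false

noncomputable section

open Complex MeasureTheory Real Set

namespace Summit.RiemannHypothesis.RiemannHypothesis.Theorems.Splittings.NbNaturalVisibility

open Literature.Barriers.RiemannHypothesis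
open Literature.Barriers.RiemannHypothesis.BettinGonek2017
open Literature.NumberTheory.LFunctions (bcfDistSq bcfDistSq_nonneg)
open Summit.RiemannHypothesis.RiemannHypothesis.Theorems.Splittings.NbGrowthDetectors
  (mollifiedSecondMoment_zero_one_le)

/-! ## Bookkeeping for the constants -/

/-- `c₁(ρ₀) = ‖ρ₀ - 1‖/‖ρ₀ + 3/2‖⁸ ≤ 1` when `Re ρ₀ ≥ ½` (`‖ρ₀ - 1‖ ≤ ‖ρ₀ + 3/2‖` and
`‖ρ₀ + 3/2‖ ≥ 2`). [folklore] -/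
theorem residueConst_le_one {ρ₀ : ℂ} (hβ : 1 / 2 ≤ ρ₀.re) : residueConst ρ₀ ≤ 1 := by
  have hR : 2 ≤ ‖ρ₀ + 3 / 2‖ := by
    have := abs_re_le_norm (ρ₀ + 3 / 2)
    have h : (ρ₀ + 3 / 2).re = ρ₀.re + 3 / 2 := by simp
    rw [h, abs_of_pos (by linarith)] at this
    linarith
  have h1 : ‖ρ₀ - 1‖ ≤ ‖ρ₀ + 3 / 2‖ := by
    have hsq : ‖ρ₀ - 1‖ ^ 2 ≤ ‖ρ₀ + 3 / 2‖ ^ 2 := by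
      rw [Complex.sq_norm, Complex.sq_norm, Complex.normSq_apply, Complex.normSq_apply]
      simp only [sub_re, one_re, sub_im, one_im, sub_zero, add_re, add_im]
      have h3re : ((3 : ℂ) / 2).re = 3 / 2 := by norm_num
      have h3im : ((3 : ℂ) / 2).im = 0 := by norm_num
      rw [h3re, h3im, add_zero]
      nlinarith
    exact (pow_le_pow_iff_left₀ (norm_nonneg _) (norm_nonneg _) two_ne_zero).1 hsq
  have h2 : ‖ρ₀ + 3 / 2‖ ≤ ‖ρ₀ + 3 / 2‖ ^ 8 := le_self_pow₀ (by linarith) (by norm_num)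
  unfold residueConst
  rw [div_le_one (by positivity)]
  exact h1.trans h2

/-- `q₀ = ∫_1^2 log² y dy ≥ 1/18` (`log y ≥ 1 - 1/y ≥ 1/3` on `[3/2, 2]`). [folklore] -/
theorem one_div_eighteen_le_integral_log_sq : 1 / 18 ≤ ∫ y in (1 : ℝ)..2, Real.log y ^ 2 := by
  have hii : ∀ a b : ℝ, 0 < a → a ≤ b →
      IntervalIntegrable (fun y : ℝ ↦ Real.log y ^ 2) volume a b := fun a b ha hab ↦
    ((Real.continuousOn_log.mono fun y hy ↦ by
      rw [uIcc_of_le hab] at hy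
      simp only [mem_compl_iff, mem_singleton_iff]
      intro h; rw [h] at hy; linarith [hy.1]).pow 2).intervalIntegrable
  have hpt : ∀ y ∈ Icc (3 / 2 : ℝ) 2, (1 / 9 : ℝ) ≤ Real.log y ^ 2 := by
    intro y hy
    have hy0 : 0 < y := by linarith [hy.1]
    have hl : 1 - y⁻¹ ≤ Real.log y := Real.one_sub_inv_le_log_of_pos hy0
    have hinv : y⁻¹ ≤ 2 / 3 := by rw [inv_le_comm₀ hy0 (by norm_num)]; linarith [hy.1]
    have h13 : 1 / 3 ≤ Real.log y := by linarith
    nlinarith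
  have hstep : ∫ _ in (3 / 2 : ℝ)..2, (1 / 9 : ℝ) ≤ ∫ y in (3 / 2 : ℝ)..2, Real.log y ^ 2 :=
    intervalIntegral.integral_mono_on (by norm_num) intervalIntegrable_const
      (hii _ _ (by norm_num) (by norm_num)) hpt
  have hsub : ∫ y in (3 / 2 : ℝ)..2, Real.log y ^ 2 ≤ ∫ y in (1 : ℝ)..2, Real.log y ^ 2 :=
    intervalIntegral.integral_mono_interval (by norm_num) (by norm_num) le_rfl
      (Filter.Eventually.of_forall fun _ ↦ by positivity) (hii _ _ one_pos one_le_two)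
  rw [intervalIntegral.integral_const, smul_eq_mul] at hstep
  linarith

/-! ## The Bettin–Gonek §2 lower bound with an explicit constant -/

/-- **Bettin–Gonek 2017 §2, explicit constant.** For a zero `ρ₀` of `ζ` with `Re ρ₀ ≥ ½`, all
`x ≥ 2` and real `t`:
`(c₁(ρ₀)²/390634) · (x^{2 Re ρ₀}/(1+|t|)⁴ + 1/x) ≤ ∫_1^x |M_y(½+it) log y|² dy`,
`c₁(ρ₀) = ‖ρ₀ - 1‖/‖ρ₀ + 3/2‖⁸`. Same proof as `BettinGonek2017_lowerBound_holds`, reading off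
`c = 1/(max(4B², 2/q₀)/c₁² + 1/(2q₀))` with `B = 625/2`, `q₀ ≥ 1/18`, `c₁ ≤ 1`.
[cite: BettinGonek2017, §2] -/
theorem bettinGonek_lowerBound_explicit {ρ₀ : ℂ} (hζ : riemannZeta ρ₀ = 0) (hβ : 1 / 2 ≤ ρ₀.re) {x : ℝ}
    (hx : 2 ≤ x) (t : ℝ) :
    residueConst ρ₀ ^ 2 / 390634 * (x ^ (2 * ρ₀.re) / (1 + |t|) ^ 4 + 1 / x) ≤
      ∫ y in (1 : ℝ)..x, ‖levinsonMollifierLog y (1 / 2 + t * I)‖ ^ 2 := by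
  set c₁ : ℝ := residueConst ρ₀ with hc₁def
  have hc₁ : 0 < c₁ := residueConst_pos hζ hβ
  have hc₁1 : c₁ ≤ 1 := residueConst_le_one hβ
  set B : ℝ := 625 / 2 with hB
  set q₀ : ℝ := ∫ y in (1 : ℝ)..2, Real.log y ^ 2 with hq₀def
  have hq₀ : 0 < q₀ := integral_log_sq_pos
  have hq18 : 1 / 18 ≤ q₀ := one_div_eighteen_le_integral_log_sq
  set K : ℝ := max (4 * B ^ 2) (2 / q₀) with hK
  have hx0 : 0 < x := by linarith
  set s : ℂ := 1 / 2 + t * I with hs_def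
  have hs : 0 ≤ s.re := by simp [hs_def]
  set P : ℝ := ∫ y in (1 : ℝ)..x, ‖levinsonMollifierLog y s‖ with hP
  set Q : ℝ := ∫ y in (1 : ℝ)..x, ‖levinsonMollifierLog y s‖ ^ 2 with hQ
  have hqQ : q₀ ≤ Q := integral_log_sq_le_integral_norm_sq hs hx
  have hQ0 : 0 < Q := lt_of_lt_of_le hq₀ hqQ
  set A : ℝ := c₁ * x ^ (ρ₀.re + 1 / 2) / (1 + |t|) ^ 2 with hAdef
  have hA0 : 0 ≤ A := by positivity
  have h1 : A ≤ B * P + 1 := firstMoment_ineq hζ hβ t (by linarith)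
  have h2 : ∀ lam : ℝ, 0 < lam → P ≤ lam * x / 2 + Q / (2 * lam) := fun lam hlam ↦
    (integral_norm_le_amgm hs (by linarith) hlam).trans (by gcongr; linarith)
  have hclaim := sq_le_of_firstMoment hA0 (by norm_num) hx0 hQ0 hq₀ (by nlinarith) h1 h2
  -- unpack `A²`
  have hA2 : A ^ 2 = c₁ ^ 2 * x * x ^ (2 * ρ₀.re) / (1 + |t|) ^ 4 := by
    rw [hAdef, div_pow, mul_pow, ← Real.rpow_natCast (x ^ (ρ₀.re + 1 / 2)) 2,
      ← Real.rpow_mul hx0.le, show (ρ₀.re + 1 / 2) * ((2 : ℕ) : ℝ) = 2 * ρ₀.re + 1 by push_cast; ring,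
      Real.rpow_add_one hx0.ne']
    ring
  have hmain : x ^ (2 * ρ₀.re) / (1 + |t|) ^ 4 ≤ K / c₁ ^ 2 * Q := by
    rw [hA2] at hclaim
    rw [div_mul_eq_mul_div, le_div_iff₀ (by positivity)]
    have h' : x ^ (2 * ρ₀.re) / (1 + |t|) ^ 4 * c₁ ^ 2 * x ≤ K * Q * x := by
      calc x ^ (2 * ρ₀.re) / (1 + |t|) ^ 4 * c₁ ^ 2 * x
          = c₁ ^ 2 * x * x ^ (2 * ρ₀.re) / (1 + |t|) ^ 4 := by ring
        _ ≤ max (4 * B ^ 2) (2 / q₀) * x * Q := hclaim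
        _ = K * Q * x := by rw [hK]; ring
    exact le_of_mul_le_mul_right h' hx0
  have hsecond : 1 / x ≤ 1 / (2 * q₀) * Q := by
    rw [div_le_iff₀ hx0]
    calc (1 : ℝ) = 1 / (2 * q₀) * (2 * q₀) := by field_simp
      _ ≤ 1 / (2 * q₀) * (Q * x) :=
          mul_le_mul_of_nonneg_left (by nlinarith) (by positivity)
      _ = 1 / (2 * q₀) * Q * x := by ring
  -- the explicit bound for the constant: `K/c₁² + 1/(2q₀) ≤ 390634/c₁²`
  have hK1 : K ≤ 390625 := by
    refine max_le (by rw [hB]; norm_num) ?_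
    rw [div_le_iff₀ hq₀]; linarith
  have hq9 : 1 / (2 * q₀) ≤ 9 / c₁ ^ 2 := by
    have h9 : 1 / (2 * q₀) ≤ 9 := by rw [div_le_iff₀ (by positivity)]; linarith
    have hc2 : c₁ ^ 2 ≤ 1 := pow_le_one₀ hc₁.le hc₁1
    refine h9.trans ?_
    rw [le_div_iff₀ (by positivity)]
    nlinarith
  have hD : K / c₁ ^ 2 + 1 / (2 * q₀) ≤ 390634 / c₁ ^ 2 := by
    have : K / c₁ ^ 2 ≤ 390625 / c₁ ^ 2 := by gcongr
    calc K / c₁ ^ 2 + 1 / (2 * q₀) ≤ 390625 / c₁ ^ 2 + 9 / c₁ ^ 2 := add_le_add this hq9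
      _ = 390634 / c₁ ^ 2 := by ring
  have hX : x ^ (2 * ρ₀.re) / (1 + |t|) ^ 4 + 1 / x ≤ Q * (390634 / c₁ ^ 2) :=
    calc x ^ (2 * ρ₀.re) / (1 + |t|) ^ 4 + 1 / x ≤ K / c₁ ^ 2 * Q + 1 / (2 * q₀) * Q :=
          add_le_add hmain hsecond
      _ = Q * (K / c₁ ^ 2 + 1 / (2 * q₀)) := by ring
      _ ≤ Q * (390634 / c₁ ^ 2) := by gcongr
  calc c₁ ^ 2 / 390634 * (x ^ (2 * ρ₀.re) / (1 + |t|) ^ 4 + 1 / x)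
      ≤ c₁ ^ 2 / 390634 * (Q * (390634 / c₁ ^ 2)) := by gcongr
    _ = Q := by field_simp

/-! ## The visibility inequality for the tail-form natural conjunct -/

/-- **Window bookkeeping.** If `bcfDistSq N ≤ B` (`B ≥ 0`) for `H ≤ N ≤ K + 1` and the prefix
`N < H` contributes at most `S`, then
`∑_{N ≤ K+1} log² N · I_N(0,1) ≤ S + (K+1) log²(K+1) (2 + 5πB)` (`I_N(0,1) ≤ 2 + 5π bcfDistSq N`).
[folklore] -/
theorem sum_log_sq_moment_le_of_window {H K : ℕ} {B S : ℝ} (hB0 : 0 ≤ B)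
    (hB : ∀ N : ℕ, H ≤ N → N ≤ K + 1 → bcfDistSq N ≤ B)
    (hS : ∑ N ∈ Finset.range H, Real.log N ^ 2 * mollifiedSecondMoment N 0 1 ≤ S) :
    ∑ N ∈ Finset.Icc 1 (K + 1), Real.log N ^ 2 * mollifiedSecondMoment N 0 1 ≤
      S + ((K + 1 : ℕ) : ℝ) * Real.log ((K + 1 : ℕ) : ℝ) ^ 2 * (2 + 5 * π * B) := by
  set f : ℕ → ℝ := fun N ↦ Real.log N ^ 2 * mollifiedSecondMoment N 0 1 with hf
  have hf0 : ∀ N, 0 ≤ f N := fun N ↦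
    mul_nonneg (sq_nonneg _) (mollifiedSecondMoment_nonneg N zero_le_one)
  rw [← Finset.sum_filter_add_sum_filter_not (Finset.Icc 1 (K + 1)) (fun N ↦ N < H) f]
  refine add_le_add ?_ ?_
  · calc ∑ N ∈ (Finset.Icc 1 (K + 1)).filter (fun N ↦ N < H), f N
        ≤ ∑ N ∈ Finset.range H, f N :=
          Finset.sum_le_sum_of_subset_of_nonneg (fun N hN ↦ by
            simp only [Finset.mem_filter, Finset.mem_Icc, Finset.mem_range] at hN ⊢
            exact hN.2) (fun N _ _ ↦ hf0 N)
      _ ≤ S := hS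
  · have hrhs0 : 0 ≤ Real.log ((K + 1 : ℕ) : ℝ) ^ 2 * (2 + 5 * π * B) := by positivity
    have hterm : ∀ N ∈ (Finset.Icc 1 (K + 1)).filter (fun N ↦ ¬ N < H),
        f N ≤ Real.log ((K + 1 : ℕ) : ℝ) ^ 2 * (2 + 5 * π * B) := by
      intro N hN
      simp only [Finset.mem_filter, Finset.mem_Icc, not_lt] at hN
      obtain ⟨⟨hN1, hNK⟩, hNH⟩ := hN
      have hlog : Real.log N ^ 2 ≤ Real.log ((K + 1 : ℕ) : ℝ) ^ 2 := by
        have h0 : 0 ≤ Real.log N := Real.log_nonneg (by exact_mod_cast hN1)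
        have h1 : Real.log N ≤ Real.log ((K + 1 : ℕ) : ℝ) :=
          Real.log_le_log (by exact_mod_cast (by omega : 0 < N)) (by exact_mod_cast hNK)
        nlinarith
      have hmom : mollifiedSecondMoment N 0 1 ≤ 2 + 5 * π * B :=
        (mollifiedSecondMoment_zero_one_le N).trans (by gcongr; exact hB N hNH hNK)
      exact mul_le_mul hlog hmom (mollifiedSecondMoment_nonneg N zero_le_one) (sq_nonneg _)
    calc ∑ N ∈ (Finset.Icc 1 (K + 1)).filter (fun N ↦ ¬ N < H), f N
        ≤ ∑ N ∈ (Finset.Icc 1 (K + 1)).filter (fun N ↦ ¬ N < H),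
            Real.log ((K + 1 : ℕ) : ℝ) ^ 2 * (2 + 5 * π * B) := Finset.sum_le_sum hterm
      _ = (((Finset.Icc 1 (K + 1)).filter (fun N ↦ ¬ N < H)).card : ℝ) *
            (Real.log ((K + 1 : ℕ) : ℝ) ^ 2 * (2 + 5 * π * B)) := by
          rw [Finset.sum_const, nsmul_eq_mul]
      _ ≤ ((K + 1 : ℕ) : ℝ) * (Real.log ((K + 1 : ℕ) : ℝ) ^ 2 * (2 + 5 * π * B)) := by
          refine mul_le_mul_of_nonneg_right ?_ hrhs0
          have hc : ((Finset.Icc 1 (K + 1)).filter (fun N ↦ ¬ N < H)).card ≤ K + 1 :=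
            (Finset.card_filter_le _ _).trans (by rw [Nat.card_Icc]; omega)
          exact_mod_cast hc
      _ = ((K + 1 : ℕ) : ℝ) * Real.log ((K + 1 : ℕ) : ℝ) ^ 2 * (2 + 5 * π * B) := by ring

/-- **Kernel visibility inequality (tail form, natural approximants).** At a zero `ρ₀` of `ζ`
with `Re ρ₀ ≥ ½`: if `bcfDistSq N ≤ B` for `H ≤ N ≤ ⌊x⌋ + 1` (`x ≥ 2`, `B ≥ 0`) and
`∑_{N < H} log² N · I_N(0,1) ≤ S`, then
`(c₁(ρ₀)²/390634) · x^{2 Re ρ₀}/16 · ∫_0^1 |ζ(½+it)|² dt ≤ 2 (S + (⌊x⌋+1) log²(⌊x⌋+1)(2+5πB))`.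
The left side grows like `x^{1+2δ}`, the right like `x log² x`: the window must break at a
polynomial scale in `1/c₁(ρ₀) ≍ |γ₀|⁷`. [cite: BettinGonek2017, §2 (engine)] -/
theorem kernel_visibility_ineq {ρ₀ : ℂ} (hζ : riemannZeta ρ₀ = 0) (hβ : 1 / 2 ≤ ρ₀.re)
    {x : ℝ} (hx : 2 ≤ x) {H : ℕ} {B S : ℝ} (hB0 : 0 ≤ B)
    (hB : ∀ N : ℕ, H ≤ N → N ≤ ⌊x⌋₊ + 1 → bcfDistSq N ≤ B)
    (hS : ∑ N ∈ Finset.range H, Real.log N ^ 2 * mollifiedSecondMoment N 0 1 ≤ S) :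
    residueConst ρ₀ ^ 2 / 390634 * x ^ (2 * ρ₀.re) / 16 *
        (∫ t in (0 : ℝ)..1, ‖riemannZeta (1 / 2 + t * I)‖ ^ 2) ≤
      2 * (S + ((⌊x⌋₊ + 1 : ℕ) : ℝ) * Real.log ((⌊x⌋₊ + 1 : ℕ) : ℝ) ^ 2 * (2 + 5 * π * B)) := by
  have h1 := BettinGonek2017_lowerBound_integrated (β := ρ₀.re) hx
    (by positivity : (0 : ℝ) ≤ residueConst ρ₀ ^ 2 / 390634) (fun t ↦ bettinGonek_lowerBound_explicit hζ hβ hx t)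
  have h2 := sum_log_sq_moment_le_of_window (K := ⌊x⌋₊) hB0 hB hS
  linarith

/-- **Kernel visibility law (tail form, natural approximants).** Let `ρ₀` be a zero of `ζ` with
`Re ρ₀ ≥ ½ + δ`, `δ > 0`; let `B, S ≥ 0` with `∑_{N < H} log² N · I_N(0,1) ≤ S`, and put
`κ = ∫_0^1 |ζ(½+it)|² dt`, `c₁ = ‖ρ₀ - 1‖/‖ρ₀ + 3/2‖⁸`. If `x ≥ 2` and
`6250144 · (2S + 32(2+5πB)/δ²) < c₁² κ x^δ`, then the window `H ≤ N ≤ ⌊x⌋+1` contains an `N`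
with `bcfDistSq N > B`: the conjunct `∀ N ≥ H, bcfDistSq N ≤ B` is refuted below
`N_vis ≤ (6250144 (2S + 32(2+5πB)/δ²)/(c₁² κ))^{1/δ} + 1` — polynomial in `|γ₀|`, in place of the
hyper-exponential three-lines scale (which remains the only kernel scale for the liminf form).
[cite: BettinGonek2017, §2 (engine)] -/
theorem kernel_visibility {ρ₀ : ℂ} (hζ : riemannZeta ρ₀ = 0) {δ : ℝ} (hδ : 0 < δ)
    (hβ : 1 / 2 + δ ≤ ρ₀.re) {H : ℕ} {B S : ℝ} (hB0 : 0 ≤ B) (hS0 : 0 ≤ S)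
    (hS : ∑ N ∈ Finset.range H, Real.log N ^ 2 * mollifiedSecondMoment N 0 1 ≤ S)
    {x : ℝ} (hx : 2 ≤ x)
    (hbig : 6250144 * (2 * S + 32 * (2 + 5 * π * B) / δ ^ 2) <
      residueConst ρ₀ ^ 2 * (∫ t in (0 : ℝ)..1, ‖riemannZeta (1 / 2 + t * I)‖ ^ 2) * x ^ δ) :
    ∃ N : ℕ, H ≤ N ∧ N ≤ ⌊x⌋₊ + 1 ∧ B < bcfDistSq N := by
  by_contra hcon
  push Not at hcon
  have hB : ∀ N : ℕ, H ≤ N → N ≤ ⌊x⌋₊ + 1 → bcfDistSq N ≤ B := fun N h1 h2 ↦ hcon N h1 h2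
  have h4 := kernel_visibility_ineq hζ (by linarith) hx hB0 hB hS
  set κ : ℝ := ∫ t in (0 : ℝ)..1, ‖riemannZeta (1 / 2 + t * I)‖ ^ 2 with hκ
  have hκ0 : 0 < κ := integral_norm_sq_riemannZeta_pos
  set K := ⌊x⌋₊ with hK
  have hx0 : 0 < x := by linarith
  have hx1 : 1 ≤ x := by linarith
  have hδ0 : δ ≠ 0 := hδ.ne'
  have hβ1 := Literature.NumberTheory.LFunctions.re_lt_one_of_riemannZeta_eq_zero hζ
  have hδ1 : δ ≤ 1 := by linarith
  set u : ℝ := x ^ δ with hu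
  have hu1 : 1 ≤ u := Real.one_le_rpow hx1 hδ.le
  have hu0 : 0 < u := by linarith
  have hxu1 : 1 ≤ x * u := by nlinarith
  have hxu0 : 0 < x * u := by positivity
  -- sizes
  have hKx : (K : ℝ) ≤ x := Nat.floor_le hx0.le
  have hK2x : ((K + 1 : ℕ) : ℝ) ≤ 2 * x := by push_cast; linarith
  have hK1pos : (0 : ℝ) < ((K + 1 : ℕ) : ℝ) := by positivity
  have hlog0 : 0 ≤ Real.log ((K + 1 : ℕ) : ℝ) :=
    Real.log_nonneg (by exact_mod_cast (by omega : 1 ≤ K + 1))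
  have hl : Real.log (2 * x) ≤ (2 * x) ^ (δ / 2) / (δ / 2) :=
    Real.log_le_rpow_div (by linarith) (by linarith)
  have hlogK : Real.log ((K + 1 : ℕ) : ℝ) ≤ (2 * x) ^ (δ / 2) / (δ / 2) :=
    (Real.log_le_log hK1pos hK2x).trans hl
  have hsq : ((2 * x) ^ (δ / 2)) ^ 2 = (2 * x) ^ δ := by
    rw [← Real.rpow_natCast, ← Real.rpow_mul (by linarith)]
    congr 1; push_cast; ring
  have h2x : (2 * x) ^ δ ≤ 2 * u := by
    rw [Real.mul_rpow (by norm_num) hx0.le]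
    have h2 : (2 : ℝ) ^ δ ≤ 2 := by
      calc (2 : ℝ) ^ δ ≤ (2 : ℝ) ^ (1 : ℝ) :=
            Real.rpow_le_rpow_of_exponent_le (by norm_num) hδ1
        _ = 2 := Real.rpow_one 2
    exact mul_le_mul_of_nonneg_right h2 hu0.le
  have hA : Real.log ((K + 1 : ℕ) : ℝ) ^ 2 ≤ 8 * u / δ ^ 2 := by
    calc Real.log ((K + 1 : ℕ) : ℝ) ^ 2 ≤ ((2 * x) ^ (δ / 2) / (δ / 2)) ^ 2 :=
          pow_le_pow_left₀ hlog0 hlogK 2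
      _ = (2 * x) ^ δ / (δ / 2) ^ 2 := by rw [div_pow, hsq]
      _ ≤ (2 * u) / (δ / 2) ^ 2 := by gcongr
      _ = 8 * u / δ ^ 2 := by field_simp; ring
  have e1 : x ^ (1 + 2 * δ) = x * (u * u) := by
    rw [Real.rpow_add hx0, Real.rpow_one, show 2 * δ = δ + δ by ring, Real.rpow_add hx0]
  have hxpow : x ^ (1 + 2 * δ) ≤ x ^ (2 * ρ₀.re) :=
    Real.rpow_le_rpow_of_exponent_le hx1 (by linarith)
  -- lower side
  have hL : residueConst ρ₀ ^ 2 * κ * (x * (u * u)) / 6250144 ≤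
      residueConst ρ₀ ^ 2 / 390634 * x ^ (2 * ρ₀.re) / 16 * κ := by
    have h' : x * (u * u) ≤ x ^ (2 * ρ₀.re) := by rw [← e1]; exact hxpow
    have hc : 0 ≤ residueConst ρ₀ ^ 2 * κ := by positivity
    calc residueConst ρ₀ ^ 2 * κ * (x * (u * u)) / 6250144
        ≤ residueConst ρ₀ ^ 2 * κ * x ^ (2 * ρ₀.re) / 6250144 := by gcongr
      _ = residueConst ρ₀ ^ 2 / 390634 * x ^ (2 * ρ₀.re) / 16 * κ := by ring
  -- upper side
  have hR : 2 * (S + ((K + 1 : ℕ) : ℝ) * Real.log ((K + 1 : ℕ) : ℝ) ^ 2 * (2 + 5 * π * B)) ≤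
      (2 * S + 32 * (2 + 5 * π * B) / δ ^ 2) * (x * u) := by
    have h1 : ((K + 1 : ℕ) : ℝ) * Real.log ((K + 1 : ℕ) : ℝ) ^ 2 ≤ (2 * x) * (8 * u / δ ^ 2) :=
      mul_le_mul hK2x hA (sq_nonneg _) (by linarith)
    have h2 : 2 * S ≤ 2 * S * (x * u) := le_mul_of_one_le_right (by linarith) hxu1
    have h3 : 0 ≤ 2 + 5 * π * B := by positivity
    calc 2 * (S + ((K + 1 : ℕ) : ℝ) * Real.log ((K + 1 : ℕ) : ℝ) ^ 2 * (2 + 5 * π * B))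
        = 2 * S + 2 * ((((K + 1 : ℕ) : ℝ) * Real.log ((K + 1 : ℕ) : ℝ) ^ 2) *
            (2 + 5 * π * B)) := by ring
      _ ≤ 2 * S * (x * u) + 2 * (((2 * x) * (8 * u / δ ^ 2)) * (2 + 5 * π * B)) := by
          gcongr
      _ = (2 * S + 32 * (2 + 5 * π * B) / δ ^ 2) * (x * u) := by ring
  -- combine and divide by `x u > 0`
  have hfin : residueConst ρ₀ ^ 2 * κ * u / 6250144 * (x * u) ≤
      (2 * S + 32 * (2 + 5 * π * B) / δ ^ 2) * (x * u) := by
    calc residueConst ρ₀ ^ 2 * κ * u / 6250144 * (x * u)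
        = residueConst ρ₀ ^ 2 * κ * (x * (u * u)) / 6250144 := by ring
      _ ≤ _ := hL.trans (h4.trans hR)
  have hdiv := le_of_mul_le_mul_right hfin hxu0
  linarith

end Summit.RiemannHypothesis.RiemannHypothesis.Theorems.Splittings.NbNaturalVisibility

end
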